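import Literature.NumberTheory.Automorphic.ArchEndoscopicChartOrbUnfoldWallPlaces      -- ★ p850894 (this seat): `endoBlock_eq_cayleyTorus_of_not_mem`, `norm_one_sub_circleExp_eq_two_mul_abs_sin`; brings ★ (α1), the atlas
import Mathlib.Analysis.Calculus.ContDiff.Bounds
import Mathlib.Analysis.Calculus.IteratedDeriv.Lemmas
import HarnessLib

/-!
# Preliminaries for the pure normal jets at a wall place: the normal line of the wall, the compact factor on it, the single-place collapse of a product integral,
# Dirac-product averaging, and the Leibniz bound for one-variable jets (stage (α4-S4) of `ALPHA4-DESIGN.v1.md`; Varadarajan 1989 §6.4, Bouaziz 1994 §3.1)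

Topic `NumberTheory/Rogawski1990`; namespace `Literature.NumberTheory.Rogawski1990`.  THEOREMS ONLY (no `def`, no instance, no axiom, no `sorry`).  Cell `pub/hodgecm-mathlib`,
crux H413 (`stmt-HodgeConjecture-24833`), line LH3 (closer stub `stub_N9`, DIRECT ROAD), organ O-L3′ conjunct (ii) pay-down for GENERAL `fH` (LH3-plan (g3) RULINGS #7 (d) ∕ #11).
Author LH3-p01 (g4).  Count-neutral.

WHAT.  The (S4) step of the design bounds the members `D_v^a (E_S · I)` near a base point `c₀` on the wall of a compact place `w₀` (`e^{ic₀_{w₀}0} = e^{ic₀_{w₀}2}`) by reading `(E_S · I)(c + s v)`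
along the NORMAL LINE of the wall as `E_rest(c) · (i e^{−iψ_s}) · A_c(ψ_s)`, `ψ_s = ψ(c) + s`, with `A_c` the averaged normalised orbital integral of ★ (α4-S3).  This file supplies the
coordinate and measure-theoretic bookkeeping, generic where possible:
* §1 the normal direction `v` (`+1` on `θ_{w₀,0}`, `−1` on `θ_{w₀,2}`, `0` elsewhere): along `c + s v` the normal coordinate `ψ = (θ₀−θ₂)/2 − mπ` moves by `s`, the centre angle
  `(θ₀+θ₂)/2`, the other slots and the other places are fixed (**`normalLine_*`**); the compact factor `E_{w₀}(c) = 1 − e^{i(θ₂−θ₀)} = (2 sin ψ) · (i e^{−iψ})` for every `m`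
  (**`one_sub_circleExp_eq_two_sin_mul`**);
* §2 **`integral_pi_subtype_eq_single`** — a product integral over the one-point index type `{w // w = w₀}` IS the integral over the factor `w₀` (Mathlib `measurePreserving_piUnique`);
* §3 **`integral_prod_dirac_eq`** — averaging against `μ ⊗ δ_y` is integration against `μ` at the parameter `y` (the finite measures fed to ★ (α4-S3)), with total mass `μ(univ)`;
* §4 **`norm_iteratedDeriv_mul_le_of_isOpen`** — Leibniz bound for one-variable jets of a product of functions `C^∞` on an open set.
HONEST LABEL: HC_CM is proved only modulo the 7 printed citations (2 remaining: hLiu418 = stmt-HodgeConjecture-24832, h413 = stmt-HodgeConjecture-24833) until rung 0 closes;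
bookkeeping, pays nothing by itself.

## References
* [Varadarajan1989] V. S. Varadarajan, *An Introduction to Harmonic Analysis on Semisimple Lie Groups*, Cambridge Stud. Adv. Math. 16 (1989), §6.4 Lemma 21, Thms 22–23.
* [Bouaziz1994IntegralesOrbitales] A. Bouaziz, *Intégrales orbitales sur les algèbres de Lie réductives*, Invent. Math. 115 (1994), §3.1 p. 579.
* [Folland1995] G. B. Folland, *A Course in Abstract Harmonic Analysis* (1995), §2.6 (2.52).
* [HormanderALPDO1] L. Hörmander, *The Analysis of Linear Partial Differential Operators I* (1990), §1.1 (Leibniz formula (1.1.9)).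
-/

set_option autoImplicit false

noncomputable section

open MeasureTheory Measure Filter Topology Set Function NumberField NumberField.InfinitePlace Matrix Complex
open Literature.NumberTheory.Automorphic Literature.NumberTheory.Automorphic.UnitaryGroup Literature.NumberTheory.Automorphic.ArchCartan
open scoped ContDiff Classical MatrixGroups Matrix ENNReal NNReal

namespace Literature.NumberTheory.Rogawski1990

/-! ## §1 The normal line of the wall of a compact place -/

section NormalLine

variable {W : Type*} (w₀ : W) (v : W → Fin 3 → ℝ) (hv0 : v w₀ 0 = 1) (hv1 : v w₀ 1 = 0) (hv2 : v w₀ 2 = -1) (hv : ∀ w, w ≠ w₀ → v w = 0)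

include hv0 hv2 in
/-- **The normal coordinate moves by `s` along `c + s v`** (`v` = `+1` on `θ_{w₀,0}`, `−1` on `θ_{w₀,2}`, `0` at the other places). [cite: Varadarajan1989, §6.4 Lemma 21] -/
theorem normalLine_psi (c : W → Fin 3 → ℝ) (m : ℤ) (s : ℝ) :
    ((c + s • v) w₀ 0 - (c + s • v) w₀ 2) / 2 - m * Real.pi = ((c w₀ 0 - c w₀ 2) / 2 - m * Real.pi) + s := by
  simp only [Pi.add_apply, Pi.smul_apply, smul_eq_mul, hv0, hv2]
  ring

include hv0 hv2 in
/-- **The centre angle is constant along the normal line.** [cite: Varadarajan1989, §6.4 Lemma 21] -/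
theorem normalLine_centre (c : W → Fin 3 → ℝ) (s : ℝ) : (c + s • v) w₀ 0 + (c + s • v) w₀ 2 = c w₀ 0 + c w₀ 2 := by
  simp only [Pi.add_apply, Pi.smul_apply, smul_eq_mul, hv0, hv2]
  ring

include hv1 in
/-- **The middle slot at `w₀` is fixed along the normal line.** [cite: Varadarajan1989, §6.4 Lemma 21] -/
theorem normalLine_apply_one (c : W → Fin 3 → ℝ) (s : ℝ) : (c + s • v) w₀ 1 = c w₀ 1 := by
  simp only [Pi.add_apply, Pi.smul_apply, smul_eq_mul, hv1, mul_zero, add_zero]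

include hv in
/-- **The other places are fixed along the normal line.** [cite: Varadarajan1989, §6.4 Lemma 21] -/
theorem normalLine_apply_of_ne (c : W → Fin 3 → ℝ) (s : ℝ) {w : W} (hw : w ≠ w₀) : (c + s • v) w = c w := by
  funext i
  simp only [Pi.add_apply, Pi.smul_apply, smul_eq_mul, hv w hw, Pi.zero_apply, mul_zero, add_zero]

/-- **The compact normalising factor on the normal line**: `1 − e^{i(θ₂−θ₀)} = (2 sin ψ) · (i e^{−iψ})` with `ψ = (θ₀ − θ₂)/2 − mπ`, for every integer `m` (`e^{2πim} = 1`).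
[cite: Varadarajan1989, §6.4 Lemma 21] -/
theorem one_sub_circleExp_eq_two_sin_mul (θ₀ θ₂ : ℝ) (m : ℤ) :
    (1 : ℂ) - (Circle.exp (θ₂ - θ₀) : ℂ) =
      ((2 * Real.sin ((θ₀ - θ₂) / 2 - m * Real.pi) : ℝ) : ℂ) * (I * Complex.exp (-(((θ₀ - θ₂) / 2 - m * Real.pi : ℝ) : ℂ) * I)) := by
  -- `θ₂ − θ₀ = −2ψ − 2mπ`
  have hθ : θ₂ - θ₀ = -2 * ((θ₀ - θ₂) / 2 - m * Real.pi) + (-m : ℤ) * (2 * Real.pi) := by push_cast; ring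
  rw [hθ, Circle.exp_add, Circle.exp_int_mul_two_pi, mul_one, Circle.coe_exp]
  set ψ : ℝ := (θ₀ - θ₂) / 2 - m * Real.pi with hψ
  -- `1 − e^{−2iψ} = e^{−iψ}(e^{iψ} − e^{−iψ}) = e^{−iψ} · 2i sin ψ`
  have h2 : Complex.exp (((-2 * ψ : ℝ) : ℂ) * I) = Complex.exp (-(ψ : ℂ) * I) * Complex.exp (-(ψ : ℂ) * I) := by
    rw [← Complex.exp_add]; congr 1; push_cast; ring
  rw [h2]
  have hsin : ((2 * Real.sin ψ : ℝ) : ℂ) = (Complex.exp ((ψ : ℂ) * I) - Complex.exp (-(ψ : ℂ) * I)) * (-I) := by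
    rw [Complex.ofReal_mul, Complex.ofReal_sin, Complex.sin]
    push_cast
    ring
  rw [hsin]
  have hprod : Complex.exp ((ψ : ℂ) * I) * Complex.exp (-(ψ : ℂ) * I) = 1 := by
    rw [← Complex.exp_add]; simp
  calc (1 : ℂ) - Complex.exp (-(ψ : ℂ) * I) * Complex.exp (-(ψ : ℂ) * I)
      = Complex.exp ((ψ : ℂ) * I) * Complex.exp (-(ψ : ℂ) * I) - Complex.exp (-(ψ : ℂ) * I) * Complex.exp (-(ψ : ℂ) * I) := by rw [hprod]
    _ = (Complex.exp ((ψ : ℂ) * I) - Complex.exp (-(ψ : ℂ) * I)) * (-I) * (I * Complex.exp (-(ψ : ℂ) * I)) := by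
        have hI : (-I) * I = 1 := by rw [neg_mul, Complex.I_mul_I, neg_neg]
        calc _ = (Complex.exp ((ψ : ℂ) * I) - Complex.exp (-(ψ : ℂ) * I)) * Complex.exp (-(ψ : ℂ) * I) := by ring
          _ = (Complex.exp ((ψ : ℂ) * I) - Complex.exp (-(ψ : ℂ) * I)) * ((-I) * I) * Complex.exp (-(ψ : ℂ) * I) := by rw [hI, mul_one]
          _ = _ := by ring

end NormalLine

/-! ## §2 A product integral over a one-point index type is the integral over that factor -/

section Single

variable {W : Type*} {G : W → Type*} [∀ w, MeasurableSpace (G w)] {E : Type*} [NormedAddCommGroup E] [NormedSpace ℝ E]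

/-- **SINGLE-PLACE COLLAPSE**: `∫_{Π_{w : {w // w = w₀}} G_w} F(g ⟨w₀, rfl⟩) d(⊗ μ_w) = ∫_{G_{w₀}} F dμ_{w₀}` (the index type `{w // w = w₀}` has one point; Mathlib `measurePreserving_piUnique`).
[cite: Folland1995, §2.6 (2.52)] -/
theorem integral_pi_subtype_eq_single (w₀ : W) [iF : Fintype {w : W // w = w₀}] (μ : ∀ w, Measure (G w)) [∀ w, SigmaFinite (μ w)] (F : G w₀ → E) :
    (∫ g : ∀ w : {w : W // w = w₀}, G w.1, F (g ⟨w₀, rfl⟩) ∂(Measure.pi fun w : {w : W // w = w₀} => μ w.1)) = ∫ h, F h ∂(μ w₀) := by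
  letI inst : Unique {w : W // w = w₀} := ⟨⟨⟨w₀, rfl⟩⟩, fun x => Subtype.ext x.2⟩
  -- the given `Fintype` structure on the one-point type is the one of `Unique` (subsingleton)
  have hF : iF = Unique.fintype := Subsingleton.elim _ _
  subst hF
  exact (measurePreserving_piUnique (fun w : {w : W // w = w₀} => μ w.1)).integral_comp' (g := F)

end Single

/-! ## §3 Averaging against `μ ⊗ δ_y` -/

section DiracProduct

variable {X Y : Type*} [MeasurableSpace X] [MeasurableSpace Y] {E : Type*} [NormedAddCommGroup E] [NormedSpace ℝ E]

/-- **`∫ F d(μ ⊗ δ_y) = ∫ F(·, y) dμ`** (Mathlib `Measure.prod_dirac` + `integral_map`). [cite: Folland1995, §2.6 (2.52)] -/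
theorem integral_prod_dirac_eq [MeasurableSingletonClass Y] (μ : Measure X) [SFinite μ] (y : Y) {F : X × Y → E} (hF : AEStronglyMeasurable F (μ.prod (Measure.dirac y))) :
    ∫ p, F p ∂(μ.prod (Measure.dirac y)) = ∫ x, F (x, y) ∂μ := by
  rw [Measure.prod_dirac] at hF ⊢
  exact integral_map measurable_prodMk_right.aemeasurable hF

/-- **Total mass of `μ ⊗ δ_y` is that of `μ`.** [cite: Folland1995, §2.6 (2.52)] -/
theorem prod_dirac_real_univ (μ : Measure X) [SFinite μ] (y : Y) : (μ.prod (Measure.dirac y)).real univ = μ.real univ := by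
  rw [measureReal_def, measureReal_def, ← univ_prod_univ, Measure.prod_prod, Measure.dirac_apply_of_mem (mem_univ y), mul_one]

end DiracProduct

/-! ## §4 Leibniz bound for one-variable jets on an open set -/

section Leibniz

variable {A : Type*} [NormedRing A] [NormedAlgebra ℝ A]

/-- **LEIBNIZ BOUND**: for `f, g` `C^∞` on an open `J ∋ t`, `‖(f·g)⁽ⁿ⁾(t)‖ ≤ Σ_{i ≤ n} C(n,i) ‖f⁽ⁱ⁾(t)‖ ‖g⁽ⁿ⁻ⁱ⁾(t)‖` (Mathlib `norm_iteratedFDerivWithin_mul_le` read on `J` through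
`iteratedDerivWithin_of_isOpen`). [cite: HormanderALPDO1, §1.1 (1.1.9)] -/
theorem norm_iteratedDeriv_mul_le_of_isOpen {J : Set ℝ} (hJ : IsOpen J) {t : ℝ} (ht : t ∈ J) {f g : ℝ → A} (hf : ContDiffOn ℝ ∞ f J) (hg : ContDiffOn ℝ ∞ g J) (n : ℕ) :
    ‖iteratedDeriv n (fun s => f s * g s) t‖ ≤ ∑ i ∈ Finset.range (n + 1), (n.choose i : ℝ) * ‖iteratedDeriv i f t‖ * ‖iteratedDeriv (n - i) g t‖ := by
  have h := norm_iteratedFDerivWithin_mul_le (𝕜 := ℝ) hf hg hJ.uniqueDiffOn ht (n := n) (by exact_mod_cast le_top)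
  rw [norm_iteratedFDerivWithin_eq_norm_iteratedDerivWithin, iteratedDerivWithin_of_isOpen hJ ht] at h
  refine h.trans (le_of_eq (Finset.sum_congr rfl fun i _ => ?_))
  rw [norm_iteratedFDerivWithin_eq_norm_iteratedDerivWithin, norm_iteratedFDerivWithin_eq_norm_iteratedDerivWithin, iteratedDerivWithin_of_isOpen hJ ht,
    iteratedDerivWithin_of_isOpen hJ ht]

end Leibniz

end Literature.NumberTheory.Rogawski1990

end
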